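import Summits.QuantumFields.YangMills.Theorems.FemtoCurvatureTwoPoint.Negative.FiniteGroupVortices

/-!
# `FemtoCurvatureTwoPoint` — the closed weight exciting both reference plaquettes is `O(λ⁸)`
# (support file for `Negative.FiniteGroupFalse`)

Negative-side support for crux `Summit.QuantumFields.YangMills.Theses.LangevinControlUV.
FemtoCurvatureTwoPoint` (item stmt-QuantumFields-9363; cdisprove gen 1), sequel of
`Negative.FiniteGroupVortices`.

`sum_closed_p0p1_le`: in the vortex gas of a finite abelian group on `(ℤ/8)⁴` with plaquette
weights `φ ≤ ε` off `0`, the total weight of the CLOSED configurations non-zero at both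
`p₀ = (0; 0,1)` and `p₁ = (e₂; 0,1)` is at most `Z_closed · (δ(λ, 8) + δ(λ, 5)²)`, `λ = |A| ε`,
`δ` the Peierls sum: either the vortex through `p₀` contains `p₁` (then it has `≥ 8` plaquettes,
`Negative.FiniteGroupVortices.eight_le_card_rcomponent_p0p1`, and the Peierls bound
`sum_closed_bigComponent_le` applies), or the configuration splits as that vortex (`≥ 5`
plaquettes, a member of its fibre) plus a closed remainder still non-zero at `p₁` (hence with a
vortex of `≥ 5` plaquettes), and the weight factorises — the two-vortex Peierls argument.
-/

noncomputable section

open Finset Function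
open Literature.MathematicalPhysics.QuantumFieldTheory
open Literature.MathematicalPhysics.QuantumFieldTheory.LatticeForm
open Literature.Probability.LatticeModels (IsRConnected rcomponent rcomponents mem_rcomponent
  rcomponent_subset mem_rcomponent_self rcomponent_eq_of_mem isRConnected_rcomponent
  mem_rcomponents_iff)
open Summit.QuantumFields.YangMills.Theorems.FemtoCurvatureTwoPoint.Negative.FiniteGroupPeierls
open Summit.QuantumFields.YangMills.Theorems.FemtoCurvatureTwoPoint.Negative.FiniteGroupVortices

namespace Summit.QuantumFields.YangMills.Theorems.FemtoCurvatureTwoPoint.Negative.FiniteGroupTwoPlaquettes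

/- At the concrete torus `L = 8` the unifier must never unfold the vortex-gas finsets or the Gibbs
factor (`Finset.univ`-sums / products over all plaquettes or configurations). -/
attribute [local irreducible] psupp Closed Fib connSets Wt

variable {A : Type*} [AddCommGroup A] [Fintype A] [DecidableEq A]

/-- The weight of a fibre: `∑_{η ∈ Fib X} Wt η ≤ (|A| ε)^{#X}`. -/
theorem sum_Fib_le {d L : ℕ} [NeZero L] {φ : A → ℝ} (hφ0 : φ 0 = 1) (hφ : ∀ a, 0 ≤ φ a)
    {ε : ℝ} (hε0 : 0 ≤ ε) (hε : ∀ a, a ≠ 0 → φ a ≤ ε) (X : Finset (Plaquette d L)) :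
    ∑ η ∈ Fib X, Wt φ η ≤ ((Fintype.card A : ℝ) * ε) ^ X.card :=
  calc ∑ η ∈ Fib X, Wt φ η ≤ ∑ η ∈ Fib X, ε ^ X.card := Finset.sum_le_sum fun η hη => by
        rw [← (mem_Fib.1 hη).2]; exact Wt_le_pow hφ0 hφ hε η
    _ = (Fib X : Finset (Plaquette d L → A)).card * ε ^ X.card := by
        rw [Finset.sum_const, nsmul_eq_mul]
    _ ≤ (Fintype.card A : ℝ) ^ X.card * ε ^ X.card :=
        mul_le_mul_of_nonneg_right (by exact_mod_cast card_Fib_le X) (pow_nonneg hε0 _)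
    _ = ((Fintype.card A : ℝ) * ε) ^ X.card := by rw [mul_pow]

/-- **Two-vortex Peierls bound.** The total closed weight of the configurations of `(ℤ/8)⁴`
non-zero at both `p₀ = (0; 0,1)` and `p₁ = (e₂; 0,1)` is at most
`Z_closed · (δ(|A|ε, 8) + δ(|A|ε, 5)²)`. -/
theorem sum_closed_p0p1_le {φ : A → ℝ} (hφ0 : φ 0 = 1) (hφ : ∀ a, 0 ≤ φ a) {ε : ℝ}
    (hε0 : 0 ≤ ε) (hε : ∀ a, a ≠ 0 → φ a ≤ ε) :
    ∑ η ∈ (Closed 4 8 A).filter (fun η => η ((0 : Site 4 8), ⟨(0, 1), h01⟩) ≠ 0 ∧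
        η ((te 2 : Site 4 8), ⟨(0, 1), h01⟩) ≠ 0), Wt φ η ≤
      (∑ η ∈ Closed 4 8 A, Wt φ η) *
        (peierlsSum 4 8 (Fintype.card A * ε) 8 + peierlsSum 4 8 (Fintype.card A * ε) 5 ^ 2) := by
  have hZc0 : 0 ≤ ∑ η ∈ Closed 4 8 A, Wt φ η := Finset.sum_nonneg fun η _ => Wt_nonneg hφ η
  have hlam0 : 0 ≤ (Fintype.card A : ℝ) * ε := by positivity
  have hPS5 : 0 ≤ peierlsSum 4 8 (Fintype.card A * ε) 5 := peierlsSum_nonneg hlam0 5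
  have hbig8 : _ ≤ (∑ η ∈ Closed 4 8 A, Wt φ η) * peierlsSum 4 8 (Fintype.card A * ε) 8 :=
    sum_closed_bigComponent_le (d := 4) (L := 8) (A := A) hφ0 hφ hε0 hε 8
  -- the closed configurations with a vortex of `≥ 5` plaquettes, as an abstract finset `T`
  obtain ⟨T, hTmem, hbig5⟩ : ∃ T : Finset (Plaquette 4 8 → A),
      (∀ η : Plaquette 4 8 → A, IsClosedPl η →
        (∃ C ∈ rcomponents CubeAdj (psupp η), 5 ≤ C.card) → η ∈ T) ∧
      ∑ η ∈ T, Wt φ η ≤ (∑ η ∈ Closed 4 8 A, Wt φ η) * peierlsSum 4 8 (Fintype.card A * ε) 5 :=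
    ⟨_, fun η hcl hC => Finset.mem_filter.2 ⟨mem_Closed.2 hcl, hC⟩,
      sum_closed_bigComponent_le (d := 4) (L := 8) (A := A) hφ0 hφ hε0 hε 5⟩
  rw [← Finset.sum_filter_add_sum_filter_not _
    (fun η => ((te 2 : Site 4 8), ⟨(0, 1), h01⟩) ∈
      rcomponent CubeAdj (psupp η) ((0 : Site 4 8), ⟨(0, 1), h01⟩))]
  rw [Finset.filter_filter, Finset.filter_filter, mul_add]
  refine add_le_add ?_ ?_
  · -- Part 1: the vortex through `p₀` contains `p₁`: it has `≥ 8` plaquettes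
    refine le_trans (Finset.sum_le_sum_of_subset_of_nonneg (fun η hη => ?_)
      (fun η _ _ => Wt_nonneg hφ η)) hbig8
    simp only [Finset.mem_filter] at hη
    obtain ⟨hcl, ⟨h0, h1⟩, hmem⟩ := hη
    refine Finset.mem_filter.2 ⟨hcl, _, mem_rcomponents_iff.2 ⟨_, mem_psupp.2 h0, rfl⟩, ?_⟩
    exact eight_le_card_rcomponent_p0p1 (mem_Closed.1 hcl) h0 h1 hmem
  · -- Part 2: the vortex `X` through `p₀` misses `p₁`; fibre over `X`
    have hmaps : ∀ η ∈ (Closed 4 8 A).filter (fun η =>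
        (η ((0 : Site 4 8), ⟨(0, 1), h01⟩) ≠ 0 ∧ η ((te 2 : Site 4 8), ⟨(0, 1), h01⟩) ≠ 0) ∧
          ¬ ((te 2 : Site 4 8), ⟨(0, 1), h01⟩) ∈
            rcomponent CubeAdj (psupp η) ((0 : Site 4 8), ⟨(0, 1), h01⟩)),
        rcomponent CubeAdj (psupp η) ((0 : Site 4 8), ⟨(0, 1), h01⟩) ∈
          (connSets 4 8).filter (fun X => 5 ≤ X.card) := by
      intro η hη
      simp only [Finset.mem_filter] at hη
      obtain ⟨hcl, ⟨h0, -⟩, -⟩ := hη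
      exact Finset.mem_filter.2 ⟨mem_connSets.2
        (isRConnected_rcomponent (fun _ _ => cubeAdj_symm) (mem_psupp.2 h0)),
        five_le_card_rcomponent_p0 (mem_Closed.1 hcl) h0⟩
    rw [← Finset.sum_fiberwise_of_maps_to hmaps]
    refine (Finset.sum_le_sum (g := fun X => ((Fintype.card A : ℝ) * ε) ^ X.card *
      ((∑ η ∈ Closed 4 8 A, Wt φ η) * peierlsSum 4 8 (Fintype.card A * ε) 5))
      (fun X hX => ?_)).trans (le_of_eq ?_)
    swap
    · rw [← Finset.sum_mul, pow_two]
      change peierlsSum 4 8 (Fintype.card A * ε) 5 * _ = _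
      ring
    -- the configurations of the part with vortex exactly `X`
    set S := ((Closed 4 8 A).filter (fun η =>
        (η ((0 : Site 4 8), ⟨(0, 1), h01⟩) ≠ 0 ∧ η ((te 2 : Site 4 8), ⟨(0, 1), h01⟩) ≠ 0) ∧
          ¬ ((te 2 : Site 4 8), ⟨(0, 1), h01⟩) ∈
            rcomponent CubeAdj (psupp η) ((0 : Site 4 8), ⟨(0, 1), h01⟩))).filter
      (fun η => rcomponent CubeAdj (psupp η) ((0 : Site 4 8), ⟨(0, 1), h01⟩) = X) with hS
    have hmemS : ∀ η ∈ S, IsClosedPl η ∧ η ((te 2 : Site 4 8), ⟨(0, 1), h01⟩) ≠ 0 ∧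
        ((te 2 : Site 4 8), ⟨(0, 1), h01⟩) ∉ X ∧ X ∈ rcomponents CubeAdj (psupp η) := by
      intro η hη
      simp only [hS, Finset.mem_filter, mem_Closed] at hη
      obtain ⟨⟨hcl, ⟨h0, h1⟩, hnot⟩, hcompX⟩ := hη
      refine ⟨hcl, h1, hcompX ▸ hnot, ?_⟩
      rw [← hcompX]
      exact mem_rcomponents_iff.2 ⟨_, mem_psupp.2 h0, rfl⟩
    -- split `η = η|_X + η|_rest`
    have hsum : ∀ η ∈ S, restrictPl η X + restrictPl η (psupp η \ X) = η := fun η _ =>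
      restrictPl_add_restrictPl Finset.disjoint_sdiff (by
        intro p hp; by_cases hpX : p ∈ X
        · exact Finset.mem_union_left _ hpX
        · exact Finset.mem_union_right _ (Finset.mem_sdiff.2 ⟨hp, hpX⟩))
    have hinj : ∀ η ∈ S, ∀ η' ∈ S, (restrictPl η X, restrictPl η (psupp η \ X)) =
        (restrictPl η' X, restrictPl η' (psupp η' \ X)) → η = η' :=
      fun η hη η' hη' h => by
        have h1 := congrArg Prod.fst h
        have h2 := congrArg Prod.snd h
        simp only at h1 h2
        rw [← hsum η hη, ← hsum η' hη', h1, h2]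
    have hmapsT : ∀ η ∈ S, (restrictPl η X, restrictPl η (psupp η \ X)) ∈ Fib X ×ˢ T := by
      intro η hη
      obtain ⟨hcl, h1, hnotX, hXc⟩ := hmemS η hη
      refine Finset.mem_product.2 ⟨restrictPl_mem_Fib_of_mem_rcomponents hcl hXc, ?_⟩
      have hcl2 := isClosedPl_restrictPl_sdiff_of_mem_rcomponents hcl hXc
      have h1' : restrictPl η (psupp η \ X) ((te 2 : Site 4 8), ⟨(0, 1), h01⟩) ≠ 0 := by
        rw [restrictPl_apply, if_pos (Finset.mem_sdiff.2 ⟨mem_psupp.2 h1, hnotX⟩)]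
        exact h1
      exact hTmem _ hcl2 ⟨_, mem_rcomponents_iff.2 ⟨_, mem_psupp.2 h1', rfl⟩,
        five_le_card_rcomponent_p1 hcl2 h1'⟩
    have hwt : ∀ η ∈ S, Wt φ η = Wt φ (restrictPl η X) * Wt φ (restrictPl η (psupp η \ X)) := by
      intro η hη
      conv_lhs => rw [← hsum η hη]
      refine Wt_add_of_disjoint hφ0 ?_
      rw [psupp_restrictPl, psupp_restrictPl]
      exact Finset.disjoint_of_subset_left Finset.inter_subset_right
        (Finset.disjoint_of_subset_right Finset.inter_subset_right Finset.disjoint_sdiff)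
    calc ∑ η ∈ S, Wt φ η
        = ∑ η ∈ S, (fun pr : (Plaquette 4 8 → A) × (Plaquette 4 8 → A) =>
            Wt φ pr.1 * Wt φ pr.2) (restrictPl η X, restrictPl η (psupp η \ X)) :=
          Finset.sum_congr rfl hwt
      _ = ∑ pr ∈ S.image (fun η => (restrictPl η X, restrictPl η (psupp η \ X))),
            Wt φ pr.1 * Wt φ pr.2 := by
          rw [Finset.sum_image hinj]
      _ ≤ ∑ pr ∈ Fib X ×ˢ T, Wt φ pr.1 * Wt φ pr.2 :=
          Finset.sum_le_sum_of_subset_of_nonneg (fun pr hpr => by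
            obtain ⟨η, hη, rfl⟩ := Finset.mem_image.1 hpr
            exact hmapsT η hη) fun pr _ _ => mul_nonneg (Wt_nonneg hφ _) (Wt_nonneg hφ _)
      _ = (∑ η₁ ∈ Fib X, Wt φ η₁) * ∑ η₂ ∈ T, Wt φ η₂ := by
          rw [Finset.sum_product, Finset.sum_mul_sum]
      _ ≤ ((Fintype.card A : ℝ) * ε) ^ X.card *
            ((∑ η ∈ Closed 4 8 A, Wt φ η) * peierlsSum 4 8 (Fintype.card A * ε) 5) :=
          mul_le_mul (sum_Fib_le hφ0 hφ hε0 hε X) hbig5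
            (Finset.sum_nonneg fun η _ => Wt_nonneg hφ η) (pow_nonneg hlam0 _)

end Summit.QuantumFields.YangMills.Theorems.FemtoCurvatureTwoPoint.Negative.FiniteGroupTwoPlaquettes

end
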